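import Literature.NumberTheory.Automorphic.Liu2021.LemD1AsPrintedIndexedNonVacuityRamifiedConverse
import HarnessLib

/-!
# [Liu2021, App. D Lemma D.1 (3)] bookkeeping — SYNTHESIS at the NON-SPLIT TAME places of ANY quadratic `E/F` (`N` odd, `v_w(N) = 1`):
# a det-line carrier with trivial central character exists ONLY at the inert places with `gcd(N, q_v + 1) > 1`

Reproduction ∕ bookkeeping (Literature, THEOREMS ONLY: no definition, no record, no named fact, no `sorry`; nothing is
asserted about Liu's oscillator representations or about the tree's constructed local Weil carriers).

Packaging sequel of ✔ `…InertCarrier.lean` (existence at inert places with `gcd(N, q_v + 1) > 1`, hypothesis `Algebra.IsUnramifiedIn`),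
✔ `…InertConverse.lean` (non-existence at inert places with `gcd(N, q_v + 1) = 1`) and ✔ `…RamifiedConverse.lean` (non-existence at ramified
places, `N` odd), stated in the `e(w|v)`-vocabulary of ✔ `…RamifiedPlace.lean` ∕ `…InertCofinite.lean` (Mathlib `Ideal.ramificationIdx'`):

* §1 `isUnramifiedIn_of_ramificationIdx'_eq_one` — at a NON-SPLIT place, `e(w|v) = 1` gives Mathlib's `Algebra.IsUnramifiedIn (𝓞 E) 𝔭_v`
  (`w` is the only prime above `v`; Mathlib `Ideal.ramificationIdx_eq_one_iff`); the converse is ✔ `…InertCofinite.ramificationIdx'_eq_one_of_isUnramifiedIn`.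
* §2 **`eq_one_of_factors_through_det_of_nonsplit`** — at a non-split place `w ∣ v` (`c • w = w`) with `v_w(N) = 1`, `N` ODD, and
  «`e(w|v) ≠ 1` OR `gcd(N, q_v + 1) = 1`», EVERY character of `U(V)(F_v)` factoring through `det` and trivial on the centre is TRIVIAL
  (ramified: ✔ `…RamifiedConverse`; inert: ✔ `…InertConverse` via §1); and the complementary existence **`exists_carrier_character_of_nonsplit`**
  — `e(w|v) = 1` AND `gcd(N, q_v + 1) > 1` give the inert carrier of ✔ `…InertCarrier` (via §1).
* §3 the CM rows (`L` CM, `F = L⁺`): the same two statements; for THE END's `N = 3` at every non-split place `w ∤ 3` of `L`: a det-line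
  `μ`-separating carrier exists iff `w` is inert over `L⁺` with `q_v ≡ 2 (mod 3)` (the two halves as separate theorems).

What this does NOT give: `N` even; wild places (`v_w(N) < 1`, where ✔ `…WildCarrier` always gives a carrier); non-line carriers; the rows' OWN
carriers `𝓢.omegaLoc v`; Lem. D.1 itself.  HC_CM is NOT proved.

Cell pub-hodgecm2 (COR-CM), audit class of the END rows `hD1''` ∕ `hD3`; seat prover-pub-hodgecm2-b10.

References: [Liu2021] Y. Liu, *Fourier–Jacobi cycles and arithmetic relative trace formula*, Camb. J. Math. 9 (2021) =
arXiv:2102.11518, App. D §D.1 Step 3 (l. 5221), Lemma D.1 (3) (l. 5233); [NeukirchANT1999] J. Neukirch, *Algebraic Number Theory* (1999),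
Ch. I §8 Prop. (8.2), Ch. I §9 Prop. (9.6), Ch. II §4 Lemma (4.6); [Mok2014] C. P. Mok, Mem. AMS 235 (2015), §1 Notation p. 5.
-/

noncomputable section

open scoped Matrix MatrixGroups
open NumberField IsDedekindDomain
open Literature.RepresentationTheory
open Literature.RepresentationTheory.Liu2021 (OscillatorStandingData)
open Literature.NumberTheory.GaloisRepresentations (HeckeCharacter)

namespace Literature.NumberTheory.Automorphic.Liu2021.LemD1IndexedNonVacuityTameSynthesis

open UnitaryGroup

/-! ## §1 At a non-split place `e(w|v) = 1` is Mathlib's `IsUnramifiedIn` -/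

section Bridge

variable {F : Type} (E : Type) [Field F] [NumberField F] [Field E] [NumberField E] [Algebra F E]
  [Algebra.IsQuadraticExtension F E] (c : E ≃ₐ[F] E) (v : HeightOneSpectrum (𝓞 F))

/-- **at a NON-SPLIT place, `e(w|v) = 1` implies that `v` is unramified in `E`** in Mathlib's sense (`Algebra.IsUnramifiedIn (𝓞 E) 𝔭_v`:
EVERY prime above `v` is unramified — here `w` is the only one, tree `PlacesOver.eq_of_smul_eq`; Mathlib `Ideal.ramificationIdx_eq_one_iff`).
[cite: NeukirchANT1999, Ch. I §8 Prop. (8.2) and §9 Prop. (9.6)] -/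
theorem isUnramifiedIn_of_ramificationIdx'_eq_one (hc : c ≠ 1) (w : PlacesOver E v) (hw : c • w.1 = w.1)
    (he : v.asIdeal.ramificationIdx' w.1.asIdeal = 1) : Algebra.IsUnramifiedIn (𝓞 E) v.asIdeal := by
  intro P hP hPover
  have hP0 : P ≠ ⊥ := Ideal.ne_bot_of_liesOver_of_ne_bot v.ne_bot P
  have hPw : P = w.1.asIdeal :=
    congrArg (fun u : PlacesOver E v => u.1.asIdeal)
      (PlacesOver.eq_of_smul_eq c hc w hw ⟨⟨P, hP, hP0⟩, HeightOneSpectrum.ext hPover.over.symm⟩)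
  subst hPw
  haveI : v.asIdeal.IsMaximal := v.isMaximal
  rw [← Ideal.ramificationIdx_eq_one_iff, ← Ideal.ramificationIdx'_eq_ramificationIdx v.asIdeal w.1.asIdeal v.ne_bot]
  exact he

end Bridge

/-! ## §2 The place model at a non-split tame place: NO det-line carrier unless `w` is inert with `gcd(N, q_v + 1) > 1` -/

section PlaceModel

variable {F : Type} (E : Type) [Field F] [NumberField F] [Field E] [NumberField E] [Algebra F E]
  [Algebra.IsQuadraticExtension F E] (v : HeightOneSpectrum (𝓞 F)) (c : E ≃ₐ[F] E)
  {δ : E} (hcδ : c δ = -δ) (hδ : δ ≠ 0)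
  (N : ℕ) (J : Matrix (Fin N) (Fin N) E) (hN : 2 ≤ N) (hJh : (J.map c)ᵀ = J) (hJdet : J.det ≠ 0)

omit [NumberField F] [Algebra.IsQuadraticExtension F E] in
include hcδ hδ in
/-- `c ≠ 1` (`c δ = −δ ≠ δ`); copy of the siblings' private lemma. [folklore] -/
private theorem hc_of_delta : c ≠ 1 := by
  rintro rfl
  rw [AlgEquiv.one_apply] at hcδ
  have h2 : (2 : E) * δ = 0 := by linear_combination hcδ
  exact hδ ((mul_eq_zero.mp h2).resolve_left two_ne_zero)

include hcδ in
/-- **NO DET-LINE CARRIER at a NON-SPLIT TAME place unless it is inert with `gcd(N, q_v + 1) > 1`.**  Let `w ∣ v` be non-split (`c • w = w`),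
`N` odd with `v_w(N) = 1`, and suppose `e(w|v) ≠ 1` (ramified) OR `gcd(N, q_v + 1) = 1`.  Then every character `Ψ` of `U(V)(F_v) = S.U` factoring
through `det` and trivial on the centre `S.scalar(E_v¹)` is trivial (✔ `…RamifiedConverse.eq_one_of_factors_through_det_of_ramified`, resp.
✔ `…InertConverse.eq_one_of_factors_through_det` via §1). [cite: Liu2021, App. D §D.1 Step 3 (l. 5221) and Lemma D.1 (3) (l. 5233)]
[cite: NeukirchANT1999, Ch. II §4 Lemma (4.6)] -/
theorem eq_one_of_factors_through_det_of_nonsplit (w : PlacesOver E v) (hw : c • w.1 = w.1) (hNodd : Odd N)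
    (hNv : Valued.v ((N : w.1.adicCompletion E)) = 1)
    (h : v.asIdeal.ramificationIdx' w.1.asIdeal ≠ 1 ∨ Nat.Coprime N (Nat.card (𝓞 F ⧸ v.asIdeal) + 1))
    (Ψ : (LemD1OfPlace.standingData E v c N J hcδ hδ hN hJh hJdet).U →* ℂˣ)
    (θ : (LemD1OfPlace.standingData E v c N J hcδ hδ hN hJh hJdet).normOne →* ℂˣ)
    (hΨ : ∀ (g : (LemD1OfPlace.standingData E v c N J hcδ hδ hN hJh hJdet).U)
      (hg : Matrix.GeneralLinearGroup.det (g : GL (Fin N) (LocalRing E v)) ∈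
        (LemD1OfPlace.standingData E v c N J hcδ hδ hN hJh hJdet).normOne),
      Ψ g = θ ⟨Matrix.GeneralLinearGroup.det (g : GL (Fin N) (LocalRing E v)), hg⟩)
    (hcen : ∀ z : (LemD1OfPlace.standingData E v c N J hcδ hδ hN hJh hJdet).normOne,
      Ψ ((LemD1OfPlace.standingData E v c N J hcδ hδ hN hJh hJdet).scalar z) = 1) :
    Ψ = 1 := by
  by_cases he : v.asIdeal.ramificationIdx' w.1.asIdeal = 1
  · have hcop : Nat.Coprime N (Nat.card (𝓞 F ⧸ v.asIdeal) + 1) := h.resolve_left (fun hne => hne he)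
    exact LemD1IndexedNonVacuityInertConverse.eq_one_of_factors_through_det E v c hcδ hδ N J hN hJh hJdet
      (isUnramifiedIn_of_ramificationIdx'_eq_one E c v (hc_of_delta E c hcδ hδ) w hw he) w hw hNv hcop Ψ θ hΨ hcen
  · exact LemD1IndexedNonVacuityRamifiedConverse.eq_one_of_factors_through_det_of_ramified E v c hcδ hδ N J hN hJh hJdet w hw he hNodd
      hNv Ψ θ hΨ hcen

include hcδ in
/-- **… and the complementary EXISTENCE**: at a non-split place with `e(w|v) = 1` (inert) and `gcd(N, q_v + 1) > 1` there IS a character `Ψ` of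
`U(V)(F_v)` trivial on the centre, trivial on an open neighbourhood of `1`, NON-trivial, with values `N`-th roots of unity — the inert carrier of
✔ `…InertCarrier.exists_inert_carrier_character` (hypothesis `IsUnramifiedIn` supplied by §1). [cite: Liu2021, App. D §D.1 Step 3 (l. 5221)]
[cite: NeukirchANT1999, Ch. I §9 Exercise 2] -/
theorem exists_carrier_character_of_nonsplit (w : PlacesOver E v) (hw : c • w.1 = w.1)
    (he : v.asIdeal.ramificationIdx' w.1.asIdeal = 1) (hNq : ¬ Nat.Coprime N (Nat.card (𝓞 F ⧸ v.asIdeal) + 1)) :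
    ∃ Ψ : (LemD1OfPlace.standingData E v c N J hcδ hδ hN hJh hJdet).U →* ℂˣ,
      (∀ z : (LemD1OfPlace.standingData E v c N J hcδ hδ hN hJh hJdet).normOne,
        Ψ ((LemD1OfPlace.standingData E v c N J hcδ hδ hN hJh hJdet).scalar z) = 1) ∧
      (∃ O : Set (LemD1OfPlace.standingData E v c N J hcδ hδ hN hJh hJdet).U, IsOpen O ∧ 1 ∈ O ∧ ∀ g ∈ O, Ψ g = 1) ∧
      (∃ g₀ : (LemD1OfPlace.standingData E v c N J hcδ hδ hN hJh hJdet).U, Ψ g₀ ≠ 1) ∧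
      (∀ g, Ψ g ^ N = 1) ∧ (∀ g, ‖((Ψ g : ℂˣ) : ℂ)‖ = 1) :=
  LemD1IndexedNonVacuityInertCarrier.exists_inert_carrier_character E v c hcδ hδ N J hN hJh hJdet
    (isUnramifiedIn_of_ramificationIdx'_eq_one E c v (hc_of_delta E c hcδ hδ) w hw he) w hw hNq

end PlaceModel

/-! ## §3 The CM rows: `L` CM, `F = L⁺`, `c` = complex conjugation; the END's `N = 3` -/

section CM

open Literature.NumberTheory.GelbartRogawski1991.UnitaryDualPair (imagUnit complexConj_imagUnit imagUnit_ne_zero)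

variable (L : Type) [Field L] [NumberField L] [IsCMField L]

local notation3 "cc" => (IsCMField.complexConj L)
local notation3 "L⁺" => (↥(maximalRealSubfield L))

variable (v : HeightOneSpectrum (𝓞 (maximalRealSubfield L))) (N : ℕ) (J : Matrix (Fin N) (Fin N) L) (hN : 2 ≤ N)
  (hJh : (J.map (IsCMField.complexConj L))ᵀ = J) (hJdet : J.det ≠ 0)

/-- **CM rows, NON-EXISTENCE half**: at a non-split tame place `w ∣ v` of `L` (`\bar w = w`, `v_w(N) = 1`, `N` odd) that is ramified over `L⁺` or
has `gcd(N, q_v + 1) = 1`, every character of `U(V)(L⁺_v)` factoring through `det` and trivial on the centre is trivial — for `N = 3`: every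
non-split `w ∤ 3` that is NOT inert with `q_v ≡ 2 (mod 3)`. [cite: Liu2021, App. D Lemma D.1 (3) (l. 5233)] [cite: NeukirchANT1999, Ch. II §4 Lemma (4.6)] -/
theorem eq_one_of_factors_through_det_of_isCMField_of_nonsplit (w : PlacesOver L v) (hw : cc • w.1 = w.1) (hNodd : Odd N)
    (hNv : Valued.v ((N : w.1.adicCompletion L)) = 1)
    (h : v.asIdeal.ramificationIdx' w.1.asIdeal ≠ 1 ∨ Nat.Coprime N (Nat.card (𝓞 L⁺ ⧸ v.asIdeal) + 1))
    (Ψ : (LemD1OfPlace.standingData L v cc N J (complexConj_imagUnit L) (imagUnit_ne_zero L) hN hJh hJdet).U →* ℂˣ)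
    (θ : (LemD1OfPlace.standingData L v cc N J (complexConj_imagUnit L) (imagUnit_ne_zero L) hN hJh hJdet).normOne →* ℂˣ)
    (hΨ : ∀ (g : (LemD1OfPlace.standingData L v cc N J (complexConj_imagUnit L) (imagUnit_ne_zero L) hN hJh hJdet).U)
      (hg : Matrix.GeneralLinearGroup.det (g : GL (Fin N) (LocalRing L v)) ∈
        (LemD1OfPlace.standingData L v cc N J (complexConj_imagUnit L) (imagUnit_ne_zero L) hN hJh hJdet).normOne),
      Ψ g = θ ⟨Matrix.GeneralLinearGroup.det (g : GL (Fin N) (LocalRing L v)), hg⟩)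
    (hcen : ∀ z : (LemD1OfPlace.standingData L v cc N J (complexConj_imagUnit L) (imagUnit_ne_zero L) hN hJh hJdet).normOne,
      Ψ ((LemD1OfPlace.standingData L v cc N J (complexConj_imagUnit L) (imagUnit_ne_zero L) hN hJh hJdet).scalar z) = 1) :
    Ψ = 1 :=
  eq_one_of_factors_through_det_of_nonsplit L v cc (complexConj_imagUnit L) (imagUnit_ne_zero L) N J hN hJh hJdet w hw hNodd hNv h Ψ θ
    hΨ hcen

/-- **CM rows, EXISTENCE half**: at an inert place `w ∣ v` of `L` (`e(w|v) = 1`) with `gcd(N, q_v + 1) > 1` the inert carrier exists — for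
`N = 3`: the inert `w` with `q_v ≡ 2 (mod 3)`. [cite: Liu2021, App. D §D.1 Step 3 (l. 5221)] [cite: NeukirchANT1999, Ch. I §9 Exercise 2] -/
theorem exists_carrier_character_of_isCMField_of_nonsplit (w : PlacesOver L v) (hw : cc • w.1 = w.1)
    (he : v.asIdeal.ramificationIdx' w.1.asIdeal = 1) (hNq : ¬ Nat.Coprime N (Nat.card (𝓞 L⁺ ⧸ v.asIdeal) + 1)) :
    ∃ Ψ : (LemD1OfPlace.standingData L v cc N J (complexConj_imagUnit L) (imagUnit_ne_zero L) hN hJh hJdet).U →* ℂˣ,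
      (∀ z : (LemD1OfPlace.standingData L v cc N J (complexConj_imagUnit L) (imagUnit_ne_zero L) hN hJh hJdet).normOne,
        Ψ ((LemD1OfPlace.standingData L v cc N J (complexConj_imagUnit L) (imagUnit_ne_zero L) hN hJh hJdet).scalar z) = 1) ∧
      (∃ O : Set (LemD1OfPlace.standingData L v cc N J (complexConj_imagUnit L) (imagUnit_ne_zero L) hN hJh hJdet).U,
        IsOpen O ∧ 1 ∈ O ∧ ∀ g ∈ O, Ψ g = 1) ∧
      (∃ g₀ : (LemD1OfPlace.standingData L v cc N J (complexConj_imagUnit L) (imagUnit_ne_zero L) hN hJh hJdet).U, Ψ g₀ ≠ 1) ∧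
      (∀ g, Ψ g ^ N = 1) ∧ (∀ g, ‖((Ψ g : ℂˣ) : ℂ)‖ = 1) :=
  exists_carrier_character_of_nonsplit L v cc (complexConj_imagUnit L) (imagUnit_ne_zero L) N J hN hJh hJdet w hw he hNq

/-- `3 ∤ q + 1` ⟺ `Nat.Coprime 3 (q + 1)` (`3` prime). [folklore] -/
private theorem coprime_three_iff {q : ℕ} : Nat.Coprime 3 (q + 1) ↔ ¬ 3 ∣ q + 1 :=
  (Nat.Prime.coprime_iff_not_dvd Nat.prime_three)

/-- **THE END's `N = 3`, NON-EXISTENCE**: at every non-split place `w ∣ v` of `L` with `v_w(3) = 1` (i.e. `w ∤ 3`) which is ramified over `L⁺`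
or has `3 ∤ q_v + 1`, no det-line carrier with trivial central character exists in the rows' place model of rank `3`.
[cite: Liu2021, App. D Lemma D.1 (3) (l. 5233)] [cite: NeukirchANT1999, Ch. II §4 Lemma (4.6)] -/
theorem eq_one_of_factors_through_det_of_isCMField_three (J₃ : Matrix (Fin 3) (Fin 3) L) (hJh₃ : (J₃.map (IsCMField.complexConj L))ᵀ = J₃)
    (hJdet₃ : J₃.det ≠ 0) (w : PlacesOver L v) (hw : cc • w.1 = w.1) (h3v : Valued.v ((3 : ℕ) : w.1.adicCompletion L) = 1)
    (h : v.asIdeal.ramificationIdx' w.1.asIdeal ≠ 1 ∨ ¬ 3 ∣ Nat.card (𝓞 L⁺ ⧸ v.asIdeal) + 1)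
    (Ψ : (LemD1OfPlace.standingData L v cc 3 J₃ (complexConj_imagUnit L) (imagUnit_ne_zero L) (by norm_num) hJh₃ hJdet₃).U →* ℂˣ)
    (θ : (LemD1OfPlace.standingData L v cc 3 J₃ (complexConj_imagUnit L) (imagUnit_ne_zero L) (by norm_num) hJh₃ hJdet₃).normOne →* ℂˣ)
    (hΨ : ∀ (g : (LemD1OfPlace.standingData L v cc 3 J₃ (complexConj_imagUnit L) (imagUnit_ne_zero L) (by norm_num) hJh₃ hJdet₃).U)
      (hg : Matrix.GeneralLinearGroup.det (g : GL (Fin 3) (LocalRing L v)) ∈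
        (LemD1OfPlace.standingData L v cc 3 J₃ (complexConj_imagUnit L) (imagUnit_ne_zero L) (by norm_num) hJh₃ hJdet₃).normOne),
      Ψ g = θ ⟨Matrix.GeneralLinearGroup.det (g : GL (Fin 3) (LocalRing L v)), hg⟩)
    (hcen : ∀ z : (LemD1OfPlace.standingData L v cc 3 J₃ (complexConj_imagUnit L) (imagUnit_ne_zero L) (by norm_num) hJh₃ hJdet₃).normOne,
      Ψ ((LemD1OfPlace.standingData L v cc 3 J₃ (complexConj_imagUnit L) (imagUnit_ne_zero L) (by norm_num) hJh₃ hJdet₃).scalar z) = 1) :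
    Ψ = 1 :=
  eq_one_of_factors_through_det_of_isCMField_of_nonsplit L v 3 J₃ (by norm_num) hJh₃ hJdet₃ w hw (by decide) h3v
    (h.imp_right coprime_three_iff.2) Ψ θ hΨ hcen

/-- **THE END's `N = 3`, EXISTENCE**: at every INERT place `w ∣ v` of `L` (`e(w|v) = 1`) with `3 ∣ q_v + 1` (`q_v ≡ 2 (mod 3)`) the inert
carrier exists in the rows' place model of rank `3`. [cite: Liu2021, App. D §D.1 Step 3 (l. 5221)] [cite: NeukirchANT1999, Ch. I §9 Exercise 2] -/
theorem exists_carrier_character_of_isCMField_three (J₃ : Matrix (Fin 3) (Fin 3) L) (hJh₃ : (J₃.map (IsCMField.complexConj L))ᵀ = J₃)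
    (hJdet₃ : J₃.det ≠ 0) (w : PlacesOver L v) (hw : cc • w.1 = w.1) (he : v.asIdeal.ramificationIdx' w.1.asIdeal = 1)
    (h3q : 3 ∣ Nat.card (𝓞 L⁺ ⧸ v.asIdeal) + 1) :
    ∃ Ψ : (LemD1OfPlace.standingData L v cc 3 J₃ (complexConj_imagUnit L) (imagUnit_ne_zero L) (by norm_num) hJh₃ hJdet₃).U →* ℂˣ,
      (∀ z : (LemD1OfPlace.standingData L v cc 3 J₃ (complexConj_imagUnit L) (imagUnit_ne_zero L) (by norm_num) hJh₃ hJdet₃).normOne,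
        Ψ ((LemD1OfPlace.standingData L v cc 3 J₃ (complexConj_imagUnit L) (imagUnit_ne_zero L) (by norm_num) hJh₃ hJdet₃).scalar z) = 1) ∧
      (∃ O : Set (LemD1OfPlace.standingData L v cc 3 J₃ (complexConj_imagUnit L) (imagUnit_ne_zero L) (by norm_num) hJh₃ hJdet₃).U,
        IsOpen O ∧ 1 ∈ O ∧ ∀ g ∈ O, Ψ g = 1) ∧
      (∃ g₀ : (LemD1OfPlace.standingData L v cc 3 J₃ (complexConj_imagUnit L) (imagUnit_ne_zero L) (by norm_num) hJh₃ hJdet₃).U, Ψ g₀ ≠ 1) ∧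
      (∀ g, Ψ g ^ 3 = 1) ∧ (∀ g, ‖((Ψ g : ℂˣ) : ℂ)‖ = 1) :=
  exists_carrier_character_of_isCMField_of_nonsplit L v 3 J₃ (by norm_num) hJh₃ hJdet₃ w hw he
    (coprime_three_iff.not_left.2 h3q)

end CM

end Literature.NumberTheory.Automorphic.Liu2021.LemD1IndexedNonVacuityTameSynthesis

end
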